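/-
Copyright (c) 2026 the pub-hodgecm-mathlib formalisation cell (harness21).  Prover seat hodgecm-mathlib-LH4-p13 (g6): Track A «(D-RAM) FOUR-FRAME» squad of crux H413,
unit U2H (ii-H), census leaf (ρ2b′-X) — socket (B) (type RamK bottom; lead LH4-p07 (g7)), organ (B-top∕ε): THE TOKEN-SIDE FACTS AND THE SIDE LETTER OF THE WELD, 2026-09-04.
-/
import Summits.HodgeConjecture.HodgeConjecture.Theorems.F0P3cDyRamSideNormCriterionRamK   -- p858055 (this seat) F1: `two_le_of_datum_of_v_two_lt_one`, `exists_mul_theta_eq_of_fixed_fixed`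
import Summits.HodgeConjecture.HodgeConjecture.Theorems.F0P3cDyRamTokenSignRamK            -- ★ p857819 (this seat): §4 `exists_diagUnit_decomp`, §5 `diag_alive_iff_exists_mul_theta_eq`
import Summits.HodgeConjecture.HodgeConjecture.Theorems.F0P3cDyRamTopBitNormBridge         -- ★ p857848 (this seat): `topBit_iff_exists_norm_decomp`; brings ★ p857764 `realizable_of_frame_ramK`
import Literature.NumberTheory.LocalFields.WildQuadraticDatumNormOneDepth                 -- ★ p857485: `v_norm_sub_one_eq_of_isRamifiedQuadraticDatum`
import Literature.NumberTheory.LocalFields.QuadraticOrderNormTwistClasses                 -- ★ (F0P3-p01 (g32)): `exists_unit_twist_eq_of_isotropic`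
import HarnessLib

/-!
# F0 · P3c · line LH4 «(D-RAM) FOUR-FRAME» — socket (B), organ (B-top∕ε): the residual hypotheses of the T5b × T5s weld on type RamK
(Rogawski 1990 §4.9; Serre 1979 Ch. V §§2–3; Jacobowitz 1962 §4)

Cell `pub/hodgecm-mathlib`, crux H413 = `stmt-HodgeConjecture-24833` (helper lane, count-neutral); THEOREMS ONLY (no definition, no instance, no notation, no named
fact, no `sorry`).  Letters: the ONE-FIELD socket-(B) currency of F0P3-p01 (g33)'s weld head `toricCensusSum_ramK_weld` (sheet `WELD.HEAD.v1` 337335d8): `ρ`, `Θ` commuting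
isometric involutions of `K` (= the third field `M`), `IsRamifiedQuadraticDatum Θ ϖE d t` with `ρϖE = ϖE`, the type-(B) letters `|α| ≤ 1`, `|α − ρα| = 1`, `|α − Θα| < 1`,
the dyadic letter `|2| < 1`; the token `μ = λ − u` (`λΘλ = 1`, `ρu = u`, `uΘu = 1`, `|μ| = exp(−m)`, `|μ − ρμ| = exp(−jλ)`); the NORMALISER `ν` (`ρν = ν`, `νΘν = 1`,
`λρλ = ν²` — the norm-one square root of `det γ`, ★ p857454 §4); the V-LETTERS `|λ − ν| = exp(−mλ)`, `2d + t ≤ mλ + 1`, `|u − ν| < |2|` (the head's choice of `V ∈ 𝓝 1`);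
and for the side letter the hyperbolic line model `h` (`Θh = h`, `h ≠ 0`, an isotropic vector), an `E`-imaginary `ω` (`ρω = ω`, `Θω = −ω`, `ω ≠ 0`) and the named input
`hf₀` of F1 (a principal unit of `F` that is not a norm from `E`).

WHAT IS PROVED.
* §1 `exists_topDecomp_mul_norm_iff` (ALIVE is blind to a unit hermitian norm factor).
* §2 **`btop_tokens_ramK … : 2 ≤ d ∧ 3d ≤ jλ + 2 + 2(d % 2) ∧ m % 2 = d % 2 ∧ d − d % 2 ≤ m + 1`** — the weld's `hd2 hjlS hmpar hmS`: `2 ≤ d`, `d ≤ t + 1` (F1 §2),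
  `d ≤ m` and `mλ ≤ jλ` from the V-letters, and the parities from ★ p857764 `realizable_of_frame_ramK` fed with ★ p857485's norm-depth law ON `M` and ★ p857977's `αK`.
* §3 **`btop_side_ramK … : 3d ≤ jλ + 2 → ∃ c₀, 2d ≤ c₀ + 1 ∧ c₀ + d ≤ jλ + 1 ∧ (SIDE ↔ BIT(h, μ, c₀))`** at `c₀ := 2d − 1`, where `BIT` is the weld's token verbatim and
  `SIDE := ∃ x j, |x| = 1 ∧ x·Θx = (λ − u)(ν + λ)(ν + u)∕(ω·ν·λ·u)·(ϖE·ΘϖE)^j` (the S9 element `κ` of ★ p857819 in primed letters `λ∕ν`, `u∕ν`): ★ translator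
  (`exists_unit_twist_eq_of_isotropic`) ⟶ ★ bridge p857848 (BIT ↔ ALIVE) ⟶ §1 ⟶ ★ p857819 §4 (explicit TOP decomposition, `k = κ·π₂^j`) ⟶ ★ p857819 §5 (ALIVE ↔ `k ∈ N`,
  with `hNF` = F1 §4 and `hNd` = ★ `WildQuadraticDatumNormSurjective`).  With F1 §3 the weld's side letter reads `ε = 1 ↔ N_{K♮∕F} κ ∈ N_{E∕F}`, i.e. `ε = (N κ, θ)_v`.

HONEST LABEL: HC_CM is proved only modulo the 7 printed citations (2 remaining named inputs: hLiu418 = stmt-HodgeConjecture-24832, h413 = stmt-HodgeConjecture-24833) until rung 0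
closes; (ρ2b′-X) :418 is an OPEN prover target — this file is a helper (`--supports`), proofs only; socket (B) is OPEN.

## References
* [Rogawski1990] J. D. Rogawski, *Automorphic Representations of Unitary Groups in Three Variables*, Ann. of Math. Stud. 123 (1990), §4.9 Prop. 4.9.1 (b) p. 55, Lemma 4.9.3 p. 56.
* [Serre1979] J.-P. Serre, *Local Fields*, GTM 67 (1979), Ch. V §2 Prop. 3, §3 Prop. 5 and Cor. 3.
* [Jacobowitz1962] R. Jacobowitz, Hermitian forms over local fields, Amer. J. Math. 84 (1962), §4.
-/

set_option autoImplicit false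

noncomputable section

open WithZero IsLocalRing
open scoped Valued

namespace Summit.HodgeConjecture.HodgeConjecture.Cruxes.H413.F0P3cDyRamOrderCountCensusRamKTop

open Literature.NumberTheory.Automorphic.UnitaryThreeFourFrame (IsRamifiedQuadraticDatum)
open Literature.NumberTheory.LocalFields.WildQuadraticDatum (v_varpi_pow v_norm_sub_one_eq_of_isRamifiedQuadraticDatum exists_mul_map_eq_of_isRamifiedQuadraticDatum)
open Literature.NumberTheory.LocalFields (isAdicComplete_valuedInteger_of_completeSpace)
open Literature.NumberTheory.LocalFields.QuadraticOrder (exists_unit_twist_eq_of_isotropic)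
open Summit.HodgeConjecture.HodgeConjecture.Cruxes.H413.F0P3cDyRamSideNormCriterionRamK (two_le_of_datum_of_v_two_lt_one v_eq_one_of_mul_theta_eq
  exists_mul_theta_eq_of_fixed_fixed)
open Summit.HodgeConjecture.HodgeConjecture.Cruxes.H413.F0P3cDyRamTokenFrameGlueRamK (exists_thetaFixed_unramified_generator)
open Summit.HodgeConjecture.HodgeConjecture.Cruxes.H413.F0P3cDyRamTokenRealizabilityRamK (realizable_of_frame_ramK)
open Summit.HodgeConjecture.HodgeConjecture.Cruxes.H413.F0P3cDyRamTokenSignRamK (exists_diagUnit_decomp diag_alive_iff_exists_mul_theta_eq)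
open Summit.HodgeConjecture.HodgeConjecture.Cruxes.H413.F0P3cDyRamTopBitNormBridge (topBit_iff_exists_norm_decomp)

variable {K : Type} [Field K] [Valued K ℤᵐ⁰] {ρ Θ : K →+* K}

/-! ## §1 ALIVE is blind to a unit hermitian-norm factor -/

/-- **`ALIVE(z·yΘy, c) ↔ ALIVE(z, c)`** for a unit `y` (`ALIVE(z, c) := ∃ x e w, |x| = 1 ∧ ρe = e ∧ |e| = 1 ∧ |w − 1| ≤ exp(−c) ∧ z = xΘx·e·w`, ★ p857848's right-hand side):
absorb `y` into `x`. [cite: Jacobowitz1962, §4] -/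
theorem exists_topDecomp_mul_norm_iff {z y : K} (hy : Valued.v y = 1) (c : ℕ) :
    (∃ x e w : K, Valued.v x = 1 ∧ ρ e = e ∧ Valued.v e = 1 ∧ Valued.v (w - 1) ≤ exp (-(c : ℤ)) ∧ z * (y * Θ y) = x * Θ x * e * w) ↔
      ∃ x e w : K, Valued.v x = 1 ∧ ρ e = e ∧ Valued.v e = 1 ∧ Valued.v (w - 1) ≤ exp (-(c : ℤ)) ∧ z = x * Θ x * e * w := by
  have hy0 : y ≠ 0 := fun h => by rw [h, map_zero] at hy; exact zero_ne_one hy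
  have hΘy0 : Θ y ≠ 0 := (map_ne_zero Θ).2 hy0
  constructor
  · rintro ⟨x, e, w, hx, hρe, he, hw, hz⟩
    refine ⟨x / y, e, w, by rw [map_div₀, hx, hy, div_one], hρe, he, hw, ?_⟩
    rw [map_div₀]
    field_simp
    linear_combination hz
  · rintro ⟨x, e, w, hx, hρe, he, hw, hz⟩
    refine ⟨x * y, e, w, by rw [Valuation.map_mul, hx, hy, one_mul], hρe, he, hw, ?_⟩
    rw [hz, map_mul]; ring

/-! ## §2 The token-side facts `hd2 hjlS hmpar hmS` of the weld -/

/-- **THE TOKEN-SIDE FACTS OF THE T5s WELD ON TYPE RamK** (`hd2`, `hjlS`, `hmpar`, `hmS` of F0P3-p01 (g33)'s `toricCensusSum_ramK_weld`, from the socket-(B) frame, the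
token and the V-letters).  `2 ≤ d`, `d ≤ t + 1` by F1 §2; `d ≤ m` since `|λ − u| ≤ max(|λ − ν|, |u − ν|) ≤ max(exp(−mλ), exp(−(t+1)))`; `mλ ≤ jλ` since
`μ − ρμ = (λ − ν) − ρ(λ − ν)`; `m ≡ d (2)` by ★ p857764 `realizable_of_frame_ramK` (norm-depth law ★ p857485 on `M`, generator `αK = α·Θα` ★ p857977).
[cite: Rogawski1990, §4.9 Prop. 4.9.1 (b) p. 55, Lemma 4.9.3 p. 56] [cite: Serre1979, Ch. V §3 Prop. 5] -/
theorem btop_tokens_ramK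
    (hρρ : ∀ x, ρ (ρ x) = x) (hvρ : ∀ x, Valued.v (ρ x) = Valued.v x) (hΘρ : ∀ x, Θ (ρ x) = ρ (Θ x))
    {α ϖE : K} (hα1 : Valued.v α ≤ 1) (hα : Valued.v (α - ρ α) = 1)
    {d t : ℕ} (hD : IsRamifiedQuadraticDatum Θ ϖE d t) (hρϖ : ρ ϖE = ϖE) (h2 : Valued.v (2 : K) < 1) (hram : Valued.v (α - Θ α) < 1)
    {lam u ν : K} (hlam : lam * Θ lam = 1) (hu : ρ u = u) (hu1 : u * Θ u = 1) (hρν : ρ ν = ν)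
    {m jl mlam : ℕ} (hm : Valued.v (lam - u) = exp (-(m : ℤ))) (hjl : Valued.v ((lam - u) - ρ (lam - u)) = exp (-(jl : ℤ)))
    (hlam1 : Valued.v (lam - ν) = exp (-(mlam : ℤ))) (hV : 2 * d + t ≤ mlam + 1) (hu2 : Valued.v (u - ν) < Valued.v (2 : K)) :
    2 ≤ d ∧ 3 * d ≤ jl + 2 + 2 * (d % 2) ∧ m % 2 = d % 2 ∧ d - d % 2 ≤ m + 1 := by
  have hD' := hD
  obtain ⟨hΘΘ, hΘv, hϖE, -, -, -, h2t⟩ := hD'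
  obtain ⟨hd2, hdt, -⟩ := two_le_of_datum_of_v_two_lt_one hD h2
  have hρΘ : ∀ x, ρ (Θ x) = Θ (ρ x) := fun x => (hΘρ x).symm
  have hπ : ∀ n : ℕ, Valued.v ϖE ^ n = exp (-(n : ℤ)) := v_varpi_pow hϖE
  rw [hπ] at h2t
  -- `d ≤ m`
  have hu2' : Valued.v (u - ν) ≤ exp (-((t : ℤ) + 1)) := by
    rcases eq_or_ne (u - ν) 0 with h0 | h0
    · rw [h0, map_zero]; exact zero_le
    · have hv0 : Valued.v (u - ν) ≠ 0 := (Valuation.ne_zero_iff _).2 h0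
      rw [← exp_log hv0] at hu2 ⊢
      rw [h2t, exp_lt_exp] at hu2
      rw [exp_le_exp]; omega
  have hdm : d ≤ m := by
    have hle : Valued.v (lam - u) ≤ max (Valued.v (lam - ν)) (Valued.v (u - ν)) := by
      rw [show lam - u = (lam - ν) - (u - ν) by ring]; exact Valuation.map_sub _ _ _
    rw [hm, hlam1] at hle
    rcases le_max_iff.1 hle with h | h
    · rw [exp_le_exp] at h; omega
    · have h' := h.trans hu2'; rw [exp_le_exp] at h'; omega
  -- `mλ ≤ jλ`
  have hmj : mlam ≤ jl := by
    have hle : Valued.v ((lam - u) - ρ (lam - u)) ≤ max (Valued.v (lam - ν)) (Valued.v (ρ (lam - ν))) := by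
      rw [show (lam - u) - ρ (lam - u) = (lam - ν) - ρ (lam - ν) by rw [map_sub, map_sub, hu, hρν]; ring]
      exact Valuation.map_sub _ _ _
    rw [hjl, hvρ, hlam1, max_self, exp_le_exp] at hle; omega
  -- the parities from ★ p857764
  obtain ⟨αK, hΘαK, hαK1, hαKρ⟩ := exists_thetaFixed_unramified_generator hΘΘ hρΘ hvρ hΘv h2 hα1 hα hram
  have hNeq : ∀ e : K, ρ e = e → ∀ r : ℕ, d ≤ r → Valued.v e = Valued.v ϖE ^ r → r % 2 ≠ d % 2 →
      Valued.v (e + Θ e + e * Θ e) = Valued.v ϖE ^ (r + d - 1) :=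
    fun e _ r hr he hpar => v_norm_sub_one_eq_of_isRamifiedQuadraticDatum hD hr he hpar
  obtain ⟨hmpar, -, -⟩ := realizable_of_frame_ramK hρρ hΘΘ hρΘ hvρ hΘv hϖE hρϖ h2 hΘαK hαK1 hαKρ hd2 hNeq hlam hu hu1 hdm hm hjl
  exact ⟨hd2, by omega, hmpar, by omega⟩

/-! ## §3 The side letter of the weld at the far depth `c₀ = 2d − 1` -/

/-- **THE SIDE LETTER OF THE T5s WELD ON TYPE RamK** (`hside` of `toricCensusSum_ramK_weld` with `ε = 1` replaced by the norm condition `SIDE`).  If far cells exist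
(`3d ≤ jλ + 2`; `jλ` enters only here — the token `|μ − ρμ| = exp(−jλ)` is not needed) then at `c₀ := 2d − 1` (so `2d ≤ c₀ + 1`, `c₀ + d ≤ jλ + 1`) the hyperbolic bit
`BIT(h, μ, c₀)` holds iff
`SIDE := ∃ x j, |x| = 1 ∧ x·Θx = (λ − u)(ν + λ)(ν + u)∕(ω·ν·λ·u)·(ϖE·ΘϖE)^j`.
Route: ★ `exists_unit_twist_eq_of_isotropic` gives a unit `ω₀` with `ρH = −H` for `H := h·ω₀Θω₀`; ★ p857848 turns `BIT(h, μ, c₀)` into `ALIVE(z, c₀)` for the unit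
`z := μ·h·(α − ρα)∕ϖE^{m−2n}`; §1 passes to `z·ω₀Θω₀ = (λ∕ν − u∕ν)·E₁` with `E₁ := ν·H·(α − ρα)∕ϖE^{m−2n}` `ρ`-fixed; ★ p857819 §4 (V-letters: `c₀ + t ≤ mλ`) decomposes
it as `k·e·w` with `k = κ·π₂^j`; ★ p857819 §5 (far: `2d ≤ c₀ + 1`; `hNF` = F1 §4, `hNd` = ★ norm surjectivity) gives `ALIVE ↔ k ∈ N`, and `k ∈ N ↔ SIDE` by valuations.
[cite: Rogawski1990, §4.9 Prop. 4.9.1 (b) p. 55, Lemma 4.9.3 p. 56] [cite: Jacobowitz1962, §4] [cite: Serre1979, Ch. V §2 Prop. 3, §3 Cor. 3] -/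
theorem btop_side_ramK [CompleteSpace K] [Finite 𝓀[K]]
    (hρρ : ∀ x, ρ (ρ x) = x) (hvρ : ∀ x, Valued.v (ρ x) = Valued.v x) (hΘρ : ∀ x, Θ (ρ x) = ρ (Θ x))
    {α ϖE : K} (hα1 : Valued.v α ≤ 1) (hα : Valued.v (α - ρ α) = 1)
    {d t : ℕ} (hD : IsRamifiedQuadraticDatum Θ ϖE d t) (hρϖ : ρ ϖE = ϖE) (h2 : Valued.v (2 : K) < 1) (hram : Valued.v (α - Θ α) < 1)
    (hf₀ : ∃ f₀ : K, ρ f₀ = f₀ ∧ Θ f₀ = f₀ ∧ Valued.v (f₀ - 1) < 1 ∧ ¬ ∃ e : K, ρ e = e ∧ e * Θ e = f₀)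
    {h : K} (hΘh : Θ h = h) (hh : h ≠ 0) (hhyper : ∃ x : K, x ≠ 0 ∧ h * Θ x * x + ρ (h * Θ x * x) = 0)
    {lam u ν ω : K} (hlam : lam * Θ lam = 1) (hu : ρ u = u) (hu1 : u * Θ u = 1)
    (hρν : ρ ν = ν) (hν1 : ν * Θ ν = 1) (hdet : lam * ρ lam = ν ^ 2) (hρω : ρ ω = ω) (hΘω : Θ ω = -ω) (hω0 : ω ≠ 0)
    {m jl mlam : ℕ} (hm : Valued.v (lam - u) = exp (-(m : ℤ)))
    (hlam1 : Valued.v (lam - ν) = exp (-(mlam : ℤ))) (hV : 2 * d + t ≤ mlam + 1) (hu2 : Valued.v (u - ν) < Valued.v (2 : K)) :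
    3 * d ≤ jl + 2 → ∃ c₀ : ℕ, 2 * d ≤ c₀ + 1 ∧ c₀ + d ≤ jl + 1 ∧
      ((∃ x : K, ∃ j : ℤ, Valued.v x = 1 ∧ x * Θ x = (lam - u) * (ν + lam) * (ν + u) / (ω * ν * lam * u) * (ϖE * Θ ϖE) ^ j) ↔
        ∃ ω₁ : Kˣ, Valued.v (ω₁ : K) = 1 ∧
          Valued.v (1 + ρ h / h / (ρ (lam - u) / (lam - u)) * (ρ ((ω₁ : K) * Θ ω₁) / ((ω₁ : K) * Θ ω₁))) ≤ exp (-(c₀ : ℤ))) := by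
  intro hfar
  have hD' := hD
  obtain ⟨hΘΘ, hΘv, hϖE, heven, hdϖ, hd1, h2t⟩ := hD'
  obtain ⟨hd2, hdt, -⟩ := two_le_of_datum_of_v_two_lt_one hD h2
  refine ⟨2 * d - 1, by omega, by omega, ?_⟩
  have hρΘ : ∀ x, ρ (Θ x) = Θ (ρ x) := fun x => (hΘρ x).symm
  have hπ : ∀ n : ℕ, Valued.v ϖE ^ n = exp (-(n : ℤ)) := v_varpi_pow hϖE
  have h2t' : Valued.v (2 : K) = exp (-(t : ℤ)) := by rw [h2t, hπ]
  have hϖ0 : ϖE ≠ 0 := fun h0 => by rw [h0, map_zero] at hϖE; exact (exp_ne_zero hϖE.symm).elim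
  have hΘϖ : Θ ϖE ≠ ϖE := by
    intro h0
    rw [h0, sub_self, map_zero, hπ] at hdϖ
    exact (exp_ne_zero hdϖ.symm).elim
  haveI : IsAdicComplete 𝓂[K] 𝒪[K] := isAdicComplete_valuedInteger_of_completeSpace hϖE
  -- ## units bookkeeping
  have hν : Valued.v ν = 1 := v_eq_one_of_mul_theta_eq hΘv hν1 (Valuation.map_one _)
  have hν0 : ν ≠ 0 := fun h0 => by rw [h0, map_zero] at hν; exact zero_ne_one hν
  have hlamv : Valued.v lam = 1 := v_eq_one_of_mul_theta_eq hΘv hlam (Valuation.map_one _)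
  have hlam0 : lam ≠ 0 := fun h0 => by rw [h0, map_zero] at hlamv; exact zero_ne_one hlamv
  have huv : Valued.v u = 1 := v_eq_one_of_mul_theta_eq hΘv hu1 (Valuation.map_one _)
  have hu0 : u ≠ 0 := fun h0 => by rw [h0, map_zero] at huv; exact zero_ne_one huv
  have hμ0 : lam - u ≠ 0 := fun h0 => by rw [h0, map_zero] at hm; exact (exp_ne_zero hm.symm).elim
  have hαne : α - ρ α ≠ 0 := fun h0 => by rw [h0, map_zero] at hα; exact zero_ne_one hα
  -- ## primed letters `λ' := λ∕ν`, `u' := u∕ν`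
  have hlamΘ' : lam / ν * Θ (lam / ν) = 1 := by
    rw [map_div₀, div_mul_div_comm, hlam, hν1, div_one]
  have hlamρ' : lam / ν * ρ (lam / ν) = 1 := by
    rw [map_div₀, hρν, div_mul_div_comm, hdet, sq, div_self (mul_ne_zero hν0 hν0)]
  have hu' : ρ (u / ν) = u / ν := by rw [map_div₀, hu, hρν]
  have hu1' : u / ν * Θ (u / ν) = 1 := by
    rw [map_div₀, div_mul_div_comm, hu1, hν1, div_one]
  have hlam1' : Valued.v (lam / ν - 1) = exp (-(mlam : ℤ)) := by
    rw [show lam / ν - 1 = (lam - ν) / ν by field_simp, map_div₀, hν, div_one, hlam1]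
  have hu2' : Valued.v (u / ν - 1) < Valued.v (2 : K) := by
    rw [show u / ν - 1 = (u - ν) / ν by field_simp, map_div₀, hν, div_one]; exact hu2
  have htm : t < mlam := by omega
  have hne' : lam / ν ≠ u / ν := fun h0 => hμ0 (by
    have h1 : lam = u := by field_simp at h0; exact h0
    rw [h1, sub_self])
  have hμ' : lam / ν - u / ν = (lam - u) / ν := by field_simp
  -- ## the translator: `H := h·ω₀Θω₀` with `ρH = −H`
  obtain ⟨ω₀, hω₀1, hω₀t⟩ := exists_unit_twist_eq_of_isotropic hΘρ hϖE hρϖ hh hhyper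
  have hω₀0 : (ω₀ : K) ≠ 0 := ω₀.ne_zero
  have hN₀0 : (ω₀ : K) * Θ ω₀ ≠ 0 := mul_ne_zero hω₀0 ((map_ne_zero Θ).2 hω₀0)
  have hN₀v : Valued.v ((ω₀ : K) * Θ ω₀) = 1 := by rw [Valuation.map_mul, hΘv, hω₀1, one_mul]
  set H := h * ((ω₀ : K) * Θ ω₀) with hH
  have hΘH : Θ H = H := by rw [hH, map_mul, map_mul, hΘh, hΘΘ]; ring
  have hρH : ρ H = -H := by
    have h1 : ρ h * ρ ((ω₀ : K) * Θ ω₀) = -(h * ((ω₀ : K) * Θ ω₀)) := by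
      field_simp at hω₀t
      linear_combination hω₀t
    rw [hH, map_mul, h1]
  have hH0 : H ≠ 0 := mul_ne_zero hh hN₀0
  -- ## the unit `z := μ·h·(α − ρα)∕ϖE^{m − 2n}` and the bridge
  obtain ⟨n, hn⟩ := heven h hΘh hh
  set π : K := ϖE ^ ((m : ℤ) - 2 * n) with hπdef
  have hρπ : ρ π = π := by rw [hπdef, map_zpow₀, hρϖ]
  have hπv : Valued.v π = exp (-((m : ℤ) - 2 * n)) := by
    rw [hπdef, map_zpow₀, hϖE, ← exp_zsmul, smul_eq_mul, mul_neg, mul_one]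
  have hπ0 : π ≠ 0 := zpow_ne_zero _ hϖ0
  set z : K := (lam - u) * h * (α - ρ α) / π with hzdef'
  have hzdef : (lam - u) * h * (α - ρ α) = π * z := by rw [hzdef']; field_simp
  have hz1 : Valued.v z = 1 := by
    rw [hzdef', map_div₀, Valuation.map_mul, Valuation.map_mul, hm, hn, hα, hπv, mul_one, ← exp_add, ← exp_sub, ← exp_zero]
    congr 1; ring
  have hbridge := topBit_iff_exists_norm_decomp hρρ hΘΘ hρΘ hvρ hΘv hϖE hρϖ heven hα1 hα hΘh hh hμ0 hρπ hπ0 hzdef hz1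
    (c := 2 * d - 1) (by omega)
  rw [hbridge, ← exists_topDecomp_mul_norm_iff (ρ := ρ) (Θ := Θ) (z := z) hω₀1 (2 * d - 1)]
  -- ## `z·ω₀Θω₀ = (λ' − u')·E₁` with `E₁` `ρ`-fixed; the explicit TOP decomposition of ★ p857819 §4
  set E₁ : K := ν * H * (α - ρ α) / π with hE₁
  have hρE : ρ E₁ = E₁ := by
    rw [hE₁, map_div₀, map_mul, map_mul, hρν, hρH, map_sub, hρρ, hρπ]; ring
  have hzE : z * ((ω₀ : K) * Θ ω₀) = (lam / ν - u / ν) * E₁ := by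
    rw [hμ', hE₁, hH, hzdef']; field_simp
  have hzE1 : Valued.v ((lam / ν - u / ν) * E₁) = 1 := by
    rw [← hzE, Valuation.map_mul, hz1, hN₀v, one_mul]
  obtain ⟨k, e, w, j, hΘk, hvk, hρe, hve, hwc, hkew, hk⟩ := exists_diagUnit_decomp hΘΘ hρΘ hΘv hϖE hρϖ heven h2t' hlamΘ' hlamρ' hlam1' htm
    hu' hu1' hu2' hρω hΘω hω0 hne' hρE hzE1 (c := 2 * d - 1) (by omega)
  rw [hzE, hkew]
  -- ## ★ p857819 §5: `ALIVE ↔ k ∈ N` at the far depth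
  have hNF : ∀ f : K, ρ f = f → Θ f = f → Valued.v f = 1 → ∃ x : K, x * Θ x = f :=
    fun f hρf hΘf hf1 => exists_mul_theta_eq_of_fixed_fixed hρρ hvρ hΘρ hD hρϖ h2 hα1 hα hram hf₀ hρf hΘf hf1
  have hNd : ∀ u₁ : K, Θ u₁ = u₁ → Valued.v (u₁ - 1) ≤ Valued.v ϖE ^ (2 * d) → ∃ x : K, x * Θ x = u₁ :=
    fun u₁ hΘu₁ hu₁ => (exists_mul_map_eq_of_isRamifiedQuadraticDatum Θ ϖE d t hD u₁ hΘu₁ hu₁).imp fun x hx => hx.1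
  rw [diag_alive_iff_exists_mul_theta_eq hΘΘ hρΘ hΘv hϖE hρϖ hΘϖ heven hd1 hNF hNd hΘk hvk hρe hve hwc rfl (by omega)]
  -- ## `k ∈ N ↔ SIDE` (`k = κ·π₂^j` is the unit on the ray `κ·π₂^ℤ`)
  have hκ : (lam / ν - u / ν) * (1 + lam / ν) * (1 + u / ν) / (ω * (lam / ν) * (u / ν)) =
      (lam - u) * (ν + lam) * (ν + u) / (ω * ν * lam * u) := by
    field_simp
  rw [hκ] at hk
  have hvπ₂ : Valued.v (ϖE * Θ ϖE) = exp (-2 : ℤ) := by rw [Valuation.map_mul, hΘv, hϖE, ← exp_add]; rfl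
  have hκ0 : (lam - u) * (ν + lam) * (ν + u) / (ω * ν * lam * u) ≠ 0 := by
    intro h0
    rw [h0, zero_mul] at hk
    rw [hk, map_zero] at hvk
    exact zero_ne_one hvk
  have hvκ0 : Valued.v ((lam - u) * (ν + lam) * (ν + u) / (ω * ν * lam * u)) ≠ 0 := (Valuation.ne_zero_iff _).2 hκ0
  constructor
  · rintro ⟨x, j', hx1, hx⟩
    have hj : j' = j := by
      have h1 : Valued.v (x * Θ x) = 1 := by rw [Valuation.map_mul, hΘv, hx1, one_mul]
      rw [hx] at h1
      have h2' := hvk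
      rw [Valuation.map_mul, map_zpow₀, hvπ₂, ← exp_zsmul] at h1
      rw [hk, Valuation.map_mul, map_zpow₀, hvπ₂, ← exp_zsmul] at h2'
      rw [← h2'] at h1
      have h3 := mul_left_cancel₀ hvκ0 h1
      have h4 := exp_injective h3
      simp only [smul_eq_mul] at h4
      omega
    exact ⟨x, by rw [hx, hk, hj]⟩
  · rintro ⟨x, hx⟩
    exact ⟨x, j, v_eq_one_of_mul_theta_eq hΘv hx hvk, by rw [hx, hk]⟩

end Summit.HodgeConjecture.HodgeConjecture.Cruxes.H413.F0P3cDyRamOrderCountCensusRamKTop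

end
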